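import Literature.MathematicalPhysics.QuantumLattice.PairFieldBoxAverageBound
import HarnessLib

/-!
# Weighted (tapered-window) box-average bound: the pair-field density is dominated by a
# positive-semidefinite-weighted sum of the translation-averaged pair–pair correlator, for EVERY state
# on a finite torus

Family `hubbard` (topic `MathematicalPhysics/QuantumLattice`); companion of
`PairFieldBoxAverageBound.lean` (crew hubbard-fast: unit weights on a window `Q`), written for the
observable crew hubbard-obs (seat p1 g2) whose thermodynamic-limit twin is
`Summits/Ventures/CertifiedManyBodySolver/Observables/PairKernelCeilingTL.lean`. Let `G` be a finite
abelian group (the torus `(ℤ/Lℤ)²`), `A : G → operators` any family (the local pairs `P_x`),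
`Δ = Σ_x A_x` (the pair field), `T` a finite index set with a placement `p : T → G` (repetitions
allowed) and REAL WEIGHTS `q : T → ℝ`. For every vector `ψ`:

  `(Σ_{i∈T} q_i)² · Re⟨ψ, Δ†Δ ψ⟩ ≤ |G| · Σ_{i,j∈T} q_i q_j Σ_x Re⟨ψ, A_x† A_{x+(p_j−p_i)} ψ⟩`
  (`sq_sum_mul_re_expect_sum_le_weighted`),

because `Σ_u (Σ_i q_i A_{u+p_i}) = (Σ_i q_i) Δ` and `‖Σ_u w_u‖² ≤ |G| Σ_u ‖w_u‖²` (Cauchy–Schwarz) with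
`w_u = (Σ_i q_i A_{u+p_i})ψ`, whose squared norms expand into the weighted correlator sum — the proof of
the unit-weight bound verbatim with `q_i • A_{u+p_i}` in place of `A_{u+v}`. Summing rank-one weights
with nonnegative coefficients gives the GRAM form: for taps `Q i j = Σ_{k∈K} w_k v_k i v_k j`, `w_k ≥ 0`,
`(Σ_{i,j} Q i j) · Re⟨ψ, Δ†Δ ψ⟩ ≤ |G| · Σ_{i,j} Q i j Σ_x Re⟨ψ, A_x† A_{x+(p_j−p_i)} ψ⟩`
(`gramSum_mul_re_expect_sum_le`) — Bochner positivity of the pair structure factor tested against the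
positive-semidefinite kernel `Q`, written without Fourier analysis. Specialised to the pair field of the
torus `(ℤ/Lℤ)²` (`pairField g L = Σ_x localPair g L x`, `|G| = L²`):
`(Σ q)² · Re⟨ψ, Δ_g† Δ_g ψ⟩ ≤ L² · Σ_{i,j} q_i q_j Σ_x Re⟨ψ, P_x† P_{x+(p_j−p_i)} ψ⟩`
(`pairField_sq_sum_mul_re_expect_le_weighted`, `…_of_site` with a `ℤ²`-valued placement reduced mod `L`,
and the Gram forms). Unit weights on a window recover `pairField_card_sq_mul_re_expect_le`.
Everything is PROVED; no definition, no named fact, no numerical input.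

## Mathlib / tree search

REUSED: `pairField`, `localPair`, `PosSemidefTrace.expect_conjTranspose_mul`, `expect`,
`card_sq_mul_re_expect_sum_le` (the unit-weight original, for the consistency remark); Mathlib
`sq_sum_le_card_mul_sum_sq`, `norm_sum_le`, `Fintype.sum_equiv`, `Equiv.addRight`. `lean search
'weighted|taper|kernel' × 'pairField'`: nothing (the Summits-side TL kernel ceiling
`kernel_mul_braggWeight_zero_le` is the only weighted statement; it lives on `ℤ²`, not on the torus).

## References

* C. N. Yang, Rev. Mod. Phys. 34 (1962) 694, §3 (positivity of `⟨Δ†Δ⟩`, ODLRO). [cite: Yang1962, §3]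
* D. J. Scalapino, Phys. Rep. 250 (1995) 329, §2 eqs. (2.2)–(2.4). [cite: Scalapino1995, §2]
* J. Capon, Proc. IEEE 57 (1969) 1408 (weighted / minimum-variance windows). [cite: Capon1969, §II]
* L. Grafakos, *Classical Fourier Analysis* (2008), Prop. 3.1.7 (the unit-weight case = Fejér).
  [cite: Grafakos2008, Prop. 3.1.7]
-/

noncomputable section

namespace Literature.MathematicalPhysics.QuantumLattice

open Matrix Finset Literature.Probability.LatticeModels
open scoped ComplexOrder BigOperators ComplexConjugate

/-! ### §1 Scalar facts (re-proved here; the unit-weight file keeps its copies private) -/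

/-- `‖Σ_{u∈s} a_u‖² ≤ |s| Σ_{u∈s} ‖a_u‖²` (Cauchy–Schwarz). [folklore] -/
private theorem norm_sum_sq_le_card_mul' {ι : Type*} (s : Finset ι) (a : ι → ℂ) :
    ‖∑ u ∈ s, a u‖ ^ 2 ≤ s.card * ∑ u ∈ s, ‖a u‖ ^ 2 :=
  calc ‖∑ u ∈ s, a u‖ ^ 2 ≤ (∑ u ∈ s, ‖a u‖) ^ 2 :=
        pow_le_pow_left₀ (norm_nonneg _) (norm_sum_le s a) 2
    _ ≤ s.card * ∑ u ∈ s, ‖a u‖ ^ 2 := sq_sum_le_card_mul_sum_sq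

/-- `Re (v̄ · v) = Σ_i ‖v_i‖²`. [folklore] -/
private theorem re_star_dotProduct_self' {m : Type*} [Fintype m] (v : m → ℂ) :
    (star v ⬝ᵥ v).re = ∑ i, ‖v i‖ ^ 2 := by
  simp only [dotProduct, Pi.star_apply, Complex.re_sum]
  refine Finset.sum_congr rfl fun i _ => ?_
  rw [Complex.star_def, ← Complex.normSq_eq_conj_mul_self, Complex.ofReal_re, Complex.normSq_eq_norm_sq]

/-- `‖Σ_u w_u‖² ≤ |G| Σ_u ‖w_u‖²` for vectors (coordinatewise Cauchy–Schwarz). [folklore] -/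
private theorem re_star_sum_dotProduct_sum_le' {G : Type*} [Fintype G] {m : Type*} [Fintype m]
    (w : G → m → ℂ) :
    (star (∑ u, w u) ⬝ᵥ ∑ u, w u).re ≤ (Fintype.card G : ℝ) * ∑ u, (star (w u) ⬝ᵥ w u).re := by
  rw [re_star_dotProduct_self']
  simp_rw [re_star_dotProduct_self']
  rw [Finset.sum_comm, Finset.mul_sum]
  refine Finset.sum_le_sum fun i _ => ?_
  rw [Finset.sum_apply]
  exact norm_sum_sq_le_card_mul' Finset.univ fun u => w u i

/-! ### §2 The weighted bound for an arbitrary operator family on a finite abelian group -/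

section Generic

variable {G : Type*} [AddCommGroup G] [Fintype G]
variable {ι : Type*} [Fintype ι]

omit [Fintype ι] in
/-- Every site is counted with total weight `Σ q`: `Σ_u Σ_{i∈T} q_i • A_{u+p_i} = (Σ_i q_i) • Σ_x A_x`.
[folklore] -/
private theorem sum_sum_smul_add_eq_sum_smul (A : G → Matrix (Finset ι) (Finset ι) ℂ) {κ : Type*}
    (T : Finset κ) (p : κ → G) (c : κ → ℂ) :
    ∑ u, ∑ i ∈ T, c i • A (u + p i) = (∑ i ∈ T, c i) • ∑ x, A x := by
  rw [Finset.sum_comm, Finset.sum_smul]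
  refine Finset.sum_congr rfl fun i _ => ?_
  rw [← Finset.smul_sum]
  congr 1
  exact Fintype.sum_equiv (Equiv.addRight (p i)) _ _ fun u => rfl

/-- `expect` is additive over finite sums of operators. [folklore] -/
private theorem expect_sum'' {β : Type*} (s : Finset β) (X : β → Matrix (Finset ι) (Finset ι) ℂ)
    (ψ : Fock ι) : expect (∑ b ∈ s, X b) ψ = ∑ b ∈ s, expect (X b) ψ := by
  simp [expect, Matrix.sum_mulVec, dotProduct_sum]

/-- `expect` is homogeneous. [folklore] -/
private theorem expect_smul'' (c : ℂ) (X : Matrix (Finset ι) (Finset ι) ℂ) (ψ : Fock ι) :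
    expect (c • X) ψ = c * expect X ψ := by
  simp [expect, Matrix.smul_mulVec, dotProduct_smul]

/-- **Weighted box-average bound (generic).** For every operator family `A : G → 𝔐` on a finite abelian
group `G`, every finite index set `T` with placement `p : T → G` and real weights `q`, and every vector `ψ`:
`(Σ_{i∈T} q_i)² Re⟨ψ, (Σ_x A_x)†(Σ_x A_x) ψ⟩ ≤ |G| Σ_{i,j∈T} q_i q_j Σ_x Re⟨ψ, A_x† A_{x+(p_j−p_i)} ψ⟩`.
[cite: Yang1962, §3] -/
theorem sq_sum_mul_re_expect_sum_le_weighted (A : G → Matrix (Finset ι) (Finset ι) ℂ) {κ : Type*}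
    (T : Finset κ) (p : κ → G) (q : κ → ℝ) (ψ : Fock ι) :
    (∑ i ∈ T, q i) ^ 2 * (expect ((∑ x, A x)ᴴ * ∑ x, A x) ψ).re ≤
      (Fintype.card G : ℝ) *
        ∑ i ∈ T, ∑ j ∈ T, q i * q j * ∑ x, (expect ((A x)ᴴ * A (x + (p j - p i))) ψ).re := by
  set w : G → Fock ι := fun u => (∑ i ∈ T, ((q i : ℝ) : ℂ) • A (u + p i)) *ᵥ ψ with hw
  -- `Σ_u w_u = (Σ q) • Δψ`
  have hsum : ∑ u, w u = ((∑ i ∈ T, q i : ℝ) : ℂ) • ((∑ x, A x) *ᵥ ψ) := by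
    simp only [hw]
    rw [← Matrix.sum_mulVec, sum_sum_smul_add_eq_sum_smul, Matrix.smul_mulVec, Complex.ofReal_sum]
  -- the left-hand side is `Re⟨Σ w, Σ w⟩`
  have hL : (∑ i ∈ T, q i) ^ 2 * (expect ((∑ x, A x)ᴴ * ∑ x, A x) ψ).re =
      (star (∑ u, w u) ⬝ᵥ ∑ u, w u).re := by
    rw [PosSemidefTrace.expect_conjTranspose_mul, hsum, star_smul, smul_dotProduct, dotProduct_smul,
      smul_smul, smul_eq_mul, Complex.star_def, Complex.conj_ofReal, ← Complex.ofReal_mul,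
      Complex.re_ofReal_mul, sq]
  -- the right-hand side is `Σ_u Re⟨w_u, w_u⟩`
  have hR : ∑ u, (star (w u) ⬝ᵥ w u).re =
      ∑ i ∈ T, ∑ j ∈ T, q i * q j * ∑ x, (expect ((A x)ᴴ * A (x + (p j - p i))) ψ).re := by
    have hu : ∀ u, (star (w u) ⬝ᵥ w u).re =
        ∑ i ∈ T, ∑ j ∈ T, q i * q j * (expect ((A (u + p i))ᴴ * A (u + p j)) ψ).re := by
      intro u
      rw [hw, ← PosSemidefTrace.expect_conjTranspose_mul, Matrix.conjTranspose_sum, Finset.sum_mul,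
        expect_sum'', Complex.re_sum]
      refine Finset.sum_congr rfl fun i _ => ?_
      rw [Finset.mul_sum, expect_sum'', Complex.re_sum]
      refine Finset.sum_congr rfl fun j _ => ?_
      rw [Matrix.conjTranspose_smul, Matrix.smul_mul, Matrix.mul_smul, smul_smul, expect_smul'',
        Complex.star_def, Complex.conj_ofReal, ← Complex.ofReal_mul, Complex.re_ofReal_mul]
    simp_rw [hu]
    rw [Finset.sum_comm]
    refine Finset.sum_congr rfl fun i _ => ?_
    rw [Finset.sum_comm]
    refine Finset.sum_congr rfl fun j _ => ?_
    have hx : ∑ u, (expect ((A (u + p i))ᴴ * A (u + p j)) ψ).re =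
        ∑ x, (expect ((A x)ᴴ * A (x + (p j - p i))) ψ).re := by
      refine Fintype.sum_equiv (Equiv.addRight (p i)) _ _ fun u => ?_
      simp only [Equiv.coe_addRight]
      rw [show u + p i + (p j - p i) = u + p j by abel]
    rw [← Finset.mul_sum, hx]
  rw [hL, ← hR]
  exact re_star_sum_dotProduct_sum_le' w

/-- **Gram (positive-semidefinite) weights.** For taps `Q i j = Σ_{k∈K} w_k · v_k i · v_k j` with `w_k ≥ 0`
on `T`: `(Σ_{i,j∈T} Q i j) Re⟨ψ, Δ†Δ ψ⟩ ≤ |G| Σ_{i,j∈T} Q i j Σ_x Re⟨ψ, A_x† A_{x+(p_j−p_i)} ψ⟩` — the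
rank-one bounds summed with the weights `w_k`. [cite: Yang1962, §3] -/
theorem gramSum_mul_re_expect_sum_le (A : G → Matrix (Finset ι) (Finset ι) ℂ) {κ K' : Type*}
    (T : Finset κ) (p : κ → G) (K : Finset K') (wt : K' → ℝ) (v : K' → κ → ℝ) (hw : ∀ k ∈ K, 0 ≤ wt k)
    (Q : κ → κ → ℝ) (hQ : ∀ i ∈ T, ∀ j ∈ T, Q i j = ∑ k ∈ K, wt k * v k i * v k j) (ψ : Fock ι) :
    (∑ i ∈ T, ∑ j ∈ T, Q i j) * (expect ((∑ x, A x)ᴴ * ∑ x, A x) ψ).re ≤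
      (Fintype.card G : ℝ) *
        ∑ i ∈ T, ∑ j ∈ T, Q i j * ∑ x, (expect ((A x)ᴴ * A (x + (p j - p i))) ψ).re := by
  set E : ℝ := (expect ((∑ x, A x)ᴴ * ∑ x, A x) ψ).re with hE
  set F : κ → κ → ℝ := fun i j => ∑ x, (expect ((A x)ᴴ * A (x + (p j - p i))) ψ).re with hF
  -- rewrite both sides as `Σ_k w_k · (rank-one expression)`
  have hlhs : (∑ i ∈ T, ∑ j ∈ T, Q i j) * E = ∑ k ∈ K, wt k * ((∑ i ∈ T, v k i) ^ 2 * E) := by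
    have h1 : ∑ i ∈ T, ∑ j ∈ T, Q i j = ∑ k ∈ K, wt k * (∑ i ∈ T, v k i) ^ 2 := by
      calc ∑ i ∈ T, ∑ j ∈ T, Q i j = ∑ i ∈ T, ∑ j ∈ T, ∑ k ∈ K, wt k * v k i * v k j :=
            Finset.sum_congr rfl fun i hi => Finset.sum_congr rfl fun j hj => hQ i hi j hj
        _ = ∑ k ∈ K, ∑ i ∈ T, ∑ j ∈ T, wt k * v k i * v k j := by
            have h1 : ∀ i ∈ T, ∑ j ∈ T, ∑ k ∈ K, wt k * v k i * v k j =
                ∑ k ∈ K, ∑ j ∈ T, wt k * v k i * v k j := fun i _ => Finset.sum_comm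
            rw [Finset.sum_congr rfl h1, Finset.sum_comm]
        _ = ∑ k ∈ K, wt k * (∑ i ∈ T, v k i) ^ 2 := by
            refine Finset.sum_congr rfl fun k _ => ?_
            rw [sq, Finset.sum_mul_sum, Finset.mul_sum]
            refine Finset.sum_congr rfl fun i _ => ?_
            rw [Finset.mul_sum]
            exact Finset.sum_congr rfl fun j _ => by ring
    rw [h1, Finset.sum_mul]
    refine Finset.sum_congr rfl fun k _ => ?_
    ring
  have hrhs : (Fintype.card G : ℝ) * ∑ i ∈ T, ∑ j ∈ T, Q i j * F i j =
      ∑ k ∈ K, wt k * ((Fintype.card G : ℝ) * ∑ i ∈ T, ∑ j ∈ T, v k i * v k j * F i j) := by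
    have h1 : ∑ i ∈ T, ∑ j ∈ T, Q i j * F i j = ∑ k ∈ K, wt k * ∑ i ∈ T, ∑ j ∈ T, v k i * v k j * F i j := by
      calc ∑ i ∈ T, ∑ j ∈ T, Q i j * F i j = ∑ i ∈ T, ∑ j ∈ T, ∑ k ∈ K, wt k * (v k i * v k j * F i j) := by
            refine Finset.sum_congr rfl fun i hi => Finset.sum_congr rfl fun j hj => ?_
            rw [hQ i hi j hj, Finset.sum_mul]
            exact Finset.sum_congr rfl fun k _ => by ring
        _ = ∑ k ∈ K, ∑ i ∈ T, ∑ j ∈ T, wt k * (v k i * v k j * F i j) := by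
            have h1 : ∀ i ∈ T, ∑ j ∈ T, ∑ k ∈ K, wt k * (v k i * v k j * F i j) =
                ∑ k ∈ K, ∑ j ∈ T, wt k * (v k i * v k j * F i j) := fun i _ => Finset.sum_comm
            rw [Finset.sum_congr rfl h1, Finset.sum_comm]
        _ = ∑ k ∈ K, wt k * ∑ i ∈ T, ∑ j ∈ T, v k i * v k j * F i j := by
            refine Finset.sum_congr rfl fun k _ => ?_
            rw [Finset.mul_sum]
            exact Finset.sum_congr rfl fun i _ => by rw [Finset.mul_sum]
    rw [h1, Finset.mul_sum]
    refine Finset.sum_congr rfl fun k _ => ?_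
    ring
  rw [hlhs, hrhs]
  exact Finset.sum_le_sum fun k hk => mul_le_mul_of_nonneg_left
    (sq_sum_mul_re_expect_sum_le_weighted A T p (v k) ψ) (hw k hk)

/-- Consistency with the unit-weight bound: `q ≡ 1` on a window `Q ⊆ G` placed by the identity gives
`card_sq_mul_re_expect_sum_le` back. -/
example (A : G → Matrix (Finset ι) (Finset ι) ℂ) (Q : Finset G) (ψ : Fock ι) :
    (Q.card : ℝ) ^ 2 * (expect ((∑ x, A x)ᴴ * ∑ x, A x) ψ).re ≤
      (Fintype.card G : ℝ) *
        ∑ v ∈ Q, ∑ v' ∈ Q, ∑ x, (expect ((A x)ᴴ * A (x + (v' - v))) ψ).re := by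
  have h := sq_sum_mul_re_expect_sum_le_weighted A Q id (fun _ => (1 : ℝ)) ψ
  simp only [Finset.sum_const, nsmul_eq_mul, mul_one, one_mul, id] at h
  exact h

end Generic

/-! ### §3 The pair field of the torus `(ℤ/Lℤ)²` -/

section Torus

variable (g : Site 2 → ℝ) (L : ℕ) [NeZero L]

/-- `|𝕋_L| = L²` as a real number. [folklore] -/
private theorem card_torusSite_two_real : (Fintype.card (TorusSite 2 L) : ℝ) = (L : ℝ) ^ 2 := by
  rw [Fintype.card_fun, ZMod.card, Fintype.card_fin]
  push_cast
  ring

/-- **Weighted box-average bound for the pair field.** For every form factor `g`, finite index set `T`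
placed on the torus by `p`, real weights `q` and every state `ψ` on `(ℤ/Lℤ)²`:
`(Σ_{i∈T} q_i)² Re⟨ψ, Δ_g† Δ_g ψ⟩ ≤ L² Σ_{i,j∈T} q_i q_j Σ_x Re⟨ψ, P_x† P_{x+(p_j−p_i)} ψ⟩`.
[cite: Scalapino1995, §2] -/
theorem pairField_sq_sum_mul_re_expect_le_weighted {κ : Type*} (T : Finset κ) (p : κ → TorusSite 2 L)
    (q : κ → ℝ) (ψ : Fock (Orb (FermionTorus 2 L))) :
    (∑ i ∈ T, q i) ^ 2 * (expect ((pairField g L)ᴴ * pairField g L) ψ).re ≤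
      (L : ℝ) ^ 2 * ∑ i ∈ T, ∑ j ∈ T, q i * q j * ∑ x : TorusSite 2 L,
        (expect ((localPair g L x)ᴴ * localPair g L (x + (p j - p i))) ψ).re := by
  have h := sq_sum_mul_re_expect_sum_le_weighted (localPair g L) T p q ψ
  rw [card_torusSite_two_real] at h
  exact h

/-- **Gram weights for the pair field**: `(Σ_{i,j} Q i j) Re⟨ψ, Δ_g† Δ_g ψ⟩ ≤
L² Σ_{i,j} Q i j Σ_x Re⟨ψ, P_x† P_{x+(p_j−p_i)} ψ⟩` for `Q i j = Σ_k w_k v_k i v_k j`, `w_k ≥ 0`.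
[cite: Scalapino1995, §2] -/
theorem pairField_gramSum_mul_re_expect_le {κ K' : Type*} (T : Finset κ) (p : κ → TorusSite 2 L)
    (K : Finset K') (wt : K' → ℝ) (v : K' → κ → ℝ) (hw : ∀ k ∈ K, 0 ≤ wt k)
    (Q : κ → κ → ℝ) (hQ : ∀ i ∈ T, ∀ j ∈ T, Q i j = ∑ k ∈ K, wt k * v k i * v k j)
    (ψ : Fock (Orb (FermionTorus 2 L))) :
    (∑ i ∈ T, ∑ j ∈ T, Q i j) * (expect ((pairField g L)ᴴ * pairField g L) ψ).re ≤
      (L : ℝ) ^ 2 * ∑ i ∈ T, ∑ j ∈ T, Q i j * ∑ x : TorusSite 2 L,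
        (expect ((localPair g L x)ᴴ * localPair g L (x + (p j - p i))) ψ).re := by
  have h := gramSum_mul_re_expect_sum_le (localPair g L) T p K wt v hw Q hQ ψ
  rw [card_torusSite_two_real] at h
  exact h

omit [NeZero L] in
/-- `Torus.proj` is additive: `proj (a - b) = proj a - proj b`. [folklore] -/
private theorem torusProj_sub' (a b : Site 2) : Torus.proj L (a - b) = Torus.proj L a - Torus.proj L b := by
  funext i
  simp [Torus.proj, Int.cast_sub]

/-- **Weighted bound with a `ℤ²`-valued placement** (the convention of the cell's correlator rows, which
displace by lattice vectors `r ∈ ℤ²` reduced mod `L`; no injectivity is needed — repetitions are allowed):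
`(Σ q)² Re⟨ψ, Δ_g† Δ_g ψ⟩ ≤ L² Σ_{i,j∈T} q_i q_j Σ_x Re⟨ψ, P_x† P_{x + proj(p_j − p_i)} ψ⟩`.
[cite: Scalapino1995, §2] -/
theorem pairField_sq_sum_mul_re_expect_le_weighted_of_site {κ : Type*} (T : Finset κ) (p : κ → Site 2)
    (q : κ → ℝ) (ψ : Fock (Orb (FermionTorus 2 L))) :
    (∑ i ∈ T, q i) ^ 2 * (expect ((pairField g L)ᴴ * pairField g L) ψ).re ≤
      (L : ℝ) ^ 2 * ∑ i ∈ T, ∑ j ∈ T, q i * q j * ∑ x : TorusSite 2 L,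
        (expect ((localPair g L x)ᴴ * localPair g L (x + Torus.proj L (p j - p i))) ψ).re := by
  have h := pairField_sq_sum_mul_re_expect_le_weighted g L T (fun i => Torus.proj L (p i)) q ψ
  simp_rw [← torusProj_sub'] at h
  exact h

/-- Gram weights with a `ℤ²`-valued placement. [cite: Scalapino1995, §2] -/
theorem pairField_gramSum_mul_re_expect_le_of_site {κ K' : Type*} (T : Finset κ) (p : κ → Site 2)
    (K : Finset K') (wt : K' → ℝ) (v : K' → κ → ℝ) (hw : ∀ k ∈ K, 0 ≤ wt k)
    (Q : κ → κ → ℝ) (hQ : ∀ i ∈ T, ∀ j ∈ T, Q i j = ∑ k ∈ K, wt k * v k i * v k j)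
    (ψ : Fock (Orb (FermionTorus 2 L))) :
    (∑ i ∈ T, ∑ j ∈ T, Q i j) * (expect ((pairField g L)ᴴ * pairField g L) ψ).re ≤
      (L : ℝ) ^ 2 * ∑ i ∈ T, ∑ j ∈ T, Q i j * ∑ x : TorusSite 2 L,
        (expect ((localPair g L x)ᴴ * localPair g L (x + Torus.proj L (p j - p i))) ψ).re := by
  have h := pairField_gramSum_mul_re_expect_le g L T (fun i => Torus.proj L (p i)) K wt v hw Q hQ ψ
  simp_rw [← torusProj_sub'] at h
  exact h

end Torus

end Literature.MathematicalPhysics.QuantumLattice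

end
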